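/-
Copyright (c) 2026 the pub-hodgecm-mathlib formalisation cell (harness21).  Prover seat hodgecm-mathlib-K2Liu-p06 (g3): Track B «K2-LIT»,
hLiu418 = stmt-HodgeConjecture-24832, LEAD F0P6-plan (g11 → g12) deal of record req649 (S1) Φ2 `K2LiuSiegelEisensteinCoeffCells` «ψ_S-twisted three cells;
for det β ≠ 0 only the big cell»; 2026-09-04.
-/
import Summits.HodgeConjecture.HodgeConjecture.Theorems.K2LiuSiegelEisensteinCoeffMiddleOrbits   -- ★ Φ2 files 1–7 + ★ B2c
import HarnessLib

/-!
# Crux `HLiu418`, ROAD Φ, organ Φ2 — THE ASSEMBLY: for a NON-DEGENERATE index (`det S ≠ 0`) the `S`-th Fourier coefficient of the Siegel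
# Eisenstein series is the twisted big-cell integral alone, `E_S(h; f) = (∫β)⁻¹ · W_S(f)(h)` — «for det β ≠ 0 only the big cell survives»

Cell `hodgecm-mathlib`, crux item hLiu418 = `stmt-HodgeConjecture-24832`, route `HCCMUnconditional`; squad K2 ∕ K2Liu, LEAD F0P6-plan (g12), dealer K2E5-plan (g5)
(CENSUS-41 row Φ2), prover K2Liu-p06 (g3).  THEOREMS ONLY; lane `--supports stmt-HodgeConjecture-24832 --as helper` (count-neutral).

THE ARGUMENT.  ★ Φ2 file 1 `fourierCoeff_cells_of_ne_one`: `∫ β·conj ψ_S·E(uh) = W_S(f)(h) + MID_S(h)`, `MID_S(h) = ∫ β(u) conj ψ_S(u) Σ'_{q ∈ REST} f(γ_q u h)`,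
REST = `P_Δ(L⁺)\H(L⁺)` minus `{[1]} ∪ [w_Δ N_Δ(L⁺)]`.  Here **`integral_rest_eq_zero`: `MID_S = 0` for `det S ≠ 0`** (`S` `T_L`-skew): Fubini for series under
(H), then REST is partitioned into right `N_Δ(L⁺)`-orbits `q ↦ O(q) = {[γ_q ν]}` (`orbit_mem`, `orbit_eq_of_mem`, `orbit_subset_rest` — REST is orbit-stable
because `{[1]}` and the free `w_Δ`-orbit are), the sum regrouped along the fibres of `q ↦ O(q)` (`tsum_sigma`), and every fibre is the orbit `O(w_χ p')`
of a middle representative: by ★ B2c `exists_siegel_mul_refl_mul_siegel` (face (X): `γ_q = p w_χ p'`, `χ` with a zero entry — `γ_q` is off the big cell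
by ★ `exists_rat_siegel_weylDelta_unip` and off `P_Δ`), whose sum vanishes by ★ Φ2 file 7 `tsum_middle_orbit_eq_zero`.  Hence
**`integral_wt_smul_conj_mul_eisenstein_eq_whittaker`**: `∫ β·conj ψ_S·E(uh; f) = W_S(f)(h)` and **`fourierCoeffDelta_eisensteinSeriesDelta_eq`**:
`E_S(h; f) := fourierCoeffDelta νN β S (E f) h = (∫ β dνN)⁻¹ · whittakerDelta νN S f h` — the Φ2 statement of the deal («for det β ≠ 0 only the big
cell»), in the setting and under the binder (H) of ★ O41.4 `constTerm_three_cells`.  With ★ Φ1 `eq_tsum_fourierCoeffDelta` this is the input of Φ3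
(Euler product of `W_S`) and Φ4 (continuation coefficient-wise).
[KudlaRallis1994, §2], [Tan1999, §3], [Shimura1997, §18.3 (18.11)], [MoeglinWaldspurger1995, II.1.7], [GelbartPiatetskishapiroRallis1987, Part A §§1–2].

HONEST LABEL.  Count-neutral helper; `HC_CM` is proved only modulo the 7 printed citations (2 remaining named inputs: hLiu418 = `stmt-HodgeConjecture-24832`,
h413 = `stmt-HodgeConjecture-24833`) until rung 0 closes.
-/

set_option autoImplicit false
set_option linter.dupNamespace false -- the mandated namespace repeats `HodgeConjecture.HodgeConjecture`

noncomputable section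

open scoped Matrix ENNReal NNReal ComplexConjugate
open NumberField IsDedekindDomain MeasureTheory MeasureTheory.Measure Filter Set Function
open Literature.NumberTheory.Automorphic Literature.NumberTheory.Automorphic.UnitaryGroup Literature.NumberTheory.GaloisRepresentations
open Literature.NumberTheory.GelbartRogawski1991 Literature.NumberTheory.GelbartRogawski1991.GRConstruction
open Literature.NumberTheory.K2Lit.SiegelDoubled Literature.MeasureTheory.Group
open UnitaryDualPair

namespace Summit.HodgeConjecture.HodgeConjecture.Cruxes.HLiu418.K2LiuSiegelEisensteinCoeffNondegenerate

open K2LiuUnipotentCoveringWeight K2LiuConstantTermBigCellUnfold K2LiuSiegelDoubledUnfold K2LiuSiegelUnipotentFourierDefs K2LiuSiegelUnipotentCharacters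
  K2LiuSiegelFourierCoeffDelta K2LiuSiegelEisensteinCoeffCells K2LiuSiegelEisensteinCoeffOrbitSum K2LiuSiegelBruhatMiddleCellDelta
  K2LiuSiegelBruhatMiddleCellExhaustion K2LiuSiegelEisensteinCoeffMiddleOrbits

variable {L : Type} [Field L] [NumberField L] [IsCMField L]
variable {N M n : ℕ} {e : Fin N × Fin M ≃ Fin n}
  {dV : Fin N → L} {hdV : ∀ i, IsCMField.complexConj L (dV i) = dV i}
  {dW : Fin M → L} {hdW : ∀ i, IsCMField.complexConj L (dW i) = dW i}

/-! ## §1 Right `N_Δ(L⁺)`-orbits in `P_Δ(L⁺)\H(L⁺)` -/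

/-- right multiplication respects cosets: `[a c] = [b c] ⟺ [a] = [b]`. [cite: MoeglinWaldspurger1995, II.1.7] -/
theorem mk_mul_right_iff (a b c : ratH L e dV hdV dW hdW) :
    (Quotient.mk (MulAction.orbitRel (siegelDeltaRat L e dV hdV dW hdW) (ratH L e dV hdV dW hdW)) (a * c) : SiegelDeltaQuot L e dV hdV dW hdW) =
        Quotient.mk (MulAction.orbitRel (siegelDeltaRat L e dV hdV dW hdW) (ratH L e dV hdV dW hdW)) (b * c) ↔
      (Quotient.mk (MulAction.orbitRel (siegelDeltaRat L e dV hdV dW hdW) (ratH L e dV hdV dW hdW)) a : SiegelDeltaQuot L e dV hdV dW hdW) =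
        Quotient.mk (MulAction.orbitRel (siegelDeltaRat L e dV hdV dW hdW) (ratH L e dV hdV dW hdW)) b := by
  rw [mk_eq_mk_iff_isSiegelDelta, mk_eq_mk_iff_isSiegelDelta, Subgroup.coe_mul, Subgroup.coe_mul, mul_inv_rev, ← mul_assoc, mul_assoc (b : HA L e dV hdV dW hdW),
    mul_inv_cancel, mul_one]

/-- the representative of `[a]` differs from `a` by `P_Δ(L⁺)` on the left: `[γ_{[a]} c] = [a c]` for every `c`. [cite: MoeglinWaldspurger1995, II.1.7] -/
theorem mk_out_mul (a c : ratH L e dV hdV dW hdW) :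
    (Quotient.mk (MulAction.orbitRel (siegelDeltaRat L e dV hdV dW hdW) (ratH L e dV hdV dW hdW))
        (Quotient.out (Quotient.mk (MulAction.orbitRel (siegelDeltaRat L e dV hdV dW hdW) (ratH L e dV hdV dW hdW)) a : SiegelDeltaQuot L e dV hdV dW hdW) * c) :
        SiegelDeltaQuot L e dV hdV dW hdW) =
      Quotient.mk (MulAction.orbitRel (siegelDeltaRat L e dV hdV dW hdW) (ratH L e dV hdV dW hdW)) (a * c) := by
  rw [mk_mul_right_iff]
  exact Quotient.out_eq _

/-- **the right `N_Δ(L⁺)`-orbit of a coset contains it** (`ν = 1`). [cite: MoeglinWaldspurger1995, II.1.7] -/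
theorem orbit_mem (q : SiegelDeltaQuot L e dV hdV dW hdW) :
    q ∈ Set.range (fun ν : unipDeltaRat L e dV hdV dW hdW =>
      (Quotient.mk (MulAction.orbitRel (siegelDeltaRat L e dV hdV dW hdW) (ratH L e dV hdV dW hdW))
        ((Quotient.out q : ratH L e dV hdV dW hdW) * ⟨((ν : unipDelta L e dV hdV dW hdW) : HA L e dV hdV dW hdW), coe_mem_ratH ν⟩) : SiegelDeltaQuot L e dV hdV dW hdW)) := by
  refine ⟨1, ?_⟩
  have h1 : (⟨(((1 : unipDeltaRat L e dV hdV dW hdW) : unipDelta L e dV hdV dW hdW) : HA L e dV hdV dW hdW), coe_mem_ratH 1⟩ : ratH L e dV hdV dW hdW) = 1 := rfl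
  simp only [h1, mul_one]
  exact Quotient.out_eq q

/-- **orbits of members coincide**: if `q' ∈ O(q)` then `O(q') = O(q)`. [cite: MoeglinWaldspurger1995, II.1.7] -/
theorem orbit_eq_of_mem {q q' : SiegelDeltaQuot L e dV hdV dW hdW}
    (hq' : q' ∈ Set.range (fun ν : unipDeltaRat L e dV hdV dW hdW =>
      (Quotient.mk (MulAction.orbitRel (siegelDeltaRat L e dV hdV dW hdW) (ratH L e dV hdV dW hdW))
        ((Quotient.out q : ratH L e dV hdV dW hdW) * ⟨((ν : unipDelta L e dV hdV dW hdW) : HA L e dV hdV dW hdW), coe_mem_ratH ν⟩) : SiegelDeltaQuot L e dV hdV dW hdW))) :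
    Set.range (fun ν : unipDeltaRat L e dV hdV dW hdW =>
      (Quotient.mk (MulAction.orbitRel (siegelDeltaRat L e dV hdV dW hdW) (ratH L e dV hdV dW hdW))
        ((Quotient.out q' : ratH L e dV hdV dW hdW) * ⟨((ν : unipDelta L e dV hdV dW hdW) : HA L e dV hdV dW hdW), coe_mem_ratH ν⟩) : SiegelDeltaQuot L e dV hdV dW hdW)) =
    Set.range (fun ν : unipDeltaRat L e dV hdV dW hdW =>
      (Quotient.mk (MulAction.orbitRel (siegelDeltaRat L e dV hdV dW hdW) (ratH L e dV hdV dW hdW))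
        ((Quotient.out q : ratH L e dV hdV dW hdW) * ⟨((ν : unipDelta L e dV hdV dW hdW) : HA L e dV hdV dW hdW), coe_mem_ratH ν⟩) : SiegelDeltaQuot L e dV hdV dW hdW)) := by
  obtain ⟨ν₀, rfl⟩ := hq'
  -- `γ_{[γ_q ν₀]} = p · γ_q ν₀` with `p ∈ P_Δ(L⁺)`
  have hP : IsSiegelDelta L e dV hdV dW hdW
      ((((Quotient.out q : ratH L e dV hdV dW hdW) : HA L e dV hdV dW hdW) * ((ν₀ : unipDelta L e dV hdV dW hdW) : HA L e dV hdV dW hdW)) *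
        (((Quotient.out (Quotient.mk (MulAction.orbitRel (siegelDeltaRat L e dV hdV dW hdW) (ratH L e dV hdV dW hdW)) ((Quotient.out q : ratH L e dV hdV dW hdW) * (⟨(((ν₀) : unipDelta L e dV hdV dW hdW) : HA L e dV hdV dW hdW), coe_mem_ratH (ν₀)⟩ : ratH L e dV hdV dW hdW)) : SiegelDeltaQuot L e dV hdV dW hdW) : ratH L e dV hdV dW hdW) :
          HA L e dV hdV dW hdW))⁻¹) := by
    have h := (mk_eq_mk_iff_isSiegelDelta _ _).1 (Quotient.out_eq (Quotient.mk (MulAction.orbitRel (siegelDeltaRat L e dV hdV dW hdW) (ratH L e dV hdV dW hdW)) ((Quotient.out q : ratH L e dV hdV dW hdW) * (⟨(((ν₀) : unipDelta L e dV hdV dW hdW) : HA L e dV hdV dW hdW), coe_mem_ratH (ν₀)⟩ : ratH L e dV hdV dW hdW)) : SiegelDeltaQuot L e dV hdV dW hdW))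
    simpa only [Subgroup.coe_mul] using h
  have hν : ∀ ν : unipDeltaRat L e dV hdV dW hdW, IsSiegelDelta L e dV hdV dW hdW (((ν : unipDelta L e dV hdV dW hdW) : HA L e dV hdV dW hdW)) := fun ν =>
    isSiegelDelta_of_mem_unipDelta L e dV hdV dW hdW (ν : unipDelta L e dV hdV dW hdW).2
  ext x
  constructor
  · rintro ⟨ν, rfl⟩
    refine ⟨ν₀ * ν, (mk_eq_mk_iff_isSiegelDelta _ _).2 ?_⟩
    have h := isSiegelDelta_inv L e dV hdV dW hdW hP
    simp only [Subgroup.coe_mul, mul_inv_rev, inv_inv, mul_assoc] at h ⊢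
    rw [mul_inv_cancel_left]
    exact h
  · rintro ⟨ν, rfl⟩
    refine ⟨ν₀⁻¹ * ν, (mk_eq_mk_iff_isSiegelDelta _ _).2 ?_⟩
    have h := hP
    simp only [Subgroup.coe_mul, InvMemClass.coe_inv, mul_inv_rev, inv_inv, mul_assoc] at h ⊢
    rw [mul_inv_cancel_left]
    exact h

section Main

variable (wq : unipDeltaRat L e dV hdV dW hdW → ratH L e dV hdV dW hdW)
  (hwq : ∀ ν, ((wq ν : ratH L e dV hdV dW hdW) : HA L e dV hdV dW hdW) =
    weylDelta L e dV hdV dW hdW * ((ν : unipDelta L e dV hdV dW hdW) : HA L e dV hdV dW hdW))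

include hwq in
/-- **REST is orbit-stable**: the orbit of a coset outside `{[1]} ∪ [w_Δ N_Δ(L⁺)]` stays outside (both removed pieces are right `N_Δ(L⁺)`-orbits).
[cite: MoeglinWaldspurger1995, II.1.7] [cite: GelbartPiatetskishapiroRallis1987, Part A §1] -/
theorem orbit_subset_rest {q : SiegelDeltaQuot L e dV hdV dW hdW}
    (hq : q ∈ (({Quotient.mk (MulAction.orbitRel (siegelDeltaRat L e dV hdV dW hdW) (ratH L e dV hdV dW hdW)) 1} ∪
      Set.range (fun ν : unipDeltaRat L e dV hdV dW hdW =>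
        (Quotient.mk (MulAction.orbitRel (siegelDeltaRat L e dV hdV dW hdW) (ratH L e dV hdV dW hdW)) (wq ν) : SiegelDeltaQuot L e dV hdV dW hdW)))ᶜ :
        Set (SiegelDeltaQuot L e dV hdV dW hdW))) :
    Set.range (fun ν : unipDeltaRat L e dV hdV dW hdW =>
      (Quotient.mk (MulAction.orbitRel (siegelDeltaRat L e dV hdV dW hdW) (ratH L e dV hdV dW hdW))
        ((Quotient.out q : ratH L e dV hdV dW hdW) * ⟨((ν : unipDelta L e dV hdV dW hdW) : HA L e dV hdV dW hdW), coe_mem_ratH ν⟩) : SiegelDeltaQuot L e dV hdV dW hdW)) ⊆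
    (({Quotient.mk (MulAction.orbitRel (siegelDeltaRat L e dV hdV dW hdW) (ratH L e dV hdV dW hdW)) 1} ∪
      Set.range (fun ν : unipDeltaRat L e dV hdV dW hdW =>
        (Quotient.mk (MulAction.orbitRel (siegelDeltaRat L e dV hdV dW hdW) (ratH L e dV hdV dW hdW)) (wq ν) : SiegelDeltaQuot L e dV hdV dW hdW)))ᶜ :
        Set (SiegelDeltaQuot L e dV hdV dW hdW)) := by
  rintro x ⟨ν, rfl⟩ hx
  apply hq
  have hν : ∀ ν : unipDeltaRat L e dV hdV dW hdW, IsSiegelDelta L e dV hdV dW hdW (((ν : unipDelta L e dV hdV dW hdW) : HA L e dV hdV dW hdW)) := fun ν =>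
    isSiegelDelta_of_mem_unipDelta L e dV hdV dW hdW (ν : unipDelta L e dV hdV dW hdW).2
  simp only [Set.mem_union, Set.mem_range] at hx ⊢
  rcases hx with hx | ⟨ν', hx⟩
  · -- `[γ_q ν] = [1] ⟹ [γ_q] = [1]`
    refine Or.inl ((Quotient.out_eq q).symm.trans ((mk_eq_mk_iff_isSiegelDelta _ _).2 ?_))
    have h := (mk_eq_mk_iff_isSiegelDelta _ _).1 hx
    simp only [Subgroup.coe_mul, OneMemClass.coe_one, one_mul, mul_inv_rev] at h ⊢
    have h2 := isSiegelDelta_mul L e dV hdV dW hdW (hν ν) h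
    rwa [mul_inv_cancel_left] at h2
  · -- `[γ_q ν] = [w_Δ ν'] ⟹ [γ_q] = [w_Δ ν' ν⁻¹]`
    refine Or.inr ⟨ν' * ν⁻¹, ((mk_eq_mk_iff_isSiegelDelta _ _).2 ?_).trans (Quotient.out_eq q)⟩
    have h := (mk_eq_mk_iff_isSiegelDelta _ _).1 hx
    simp only [Subgroup.coe_mul, InvMemClass.coe_inv, hwq, mul_inv_rev, inv_inv, mul_assoc] at h ⊢
    exact h

variable [MeasurableSpace (unipDelta L e dV hdV dW hdW)] [BorelSpace (unipDelta L e dV hdV dW hdW)]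

include hwq in
/-- **THE MIDDLE TERM VANISHES: `MID_S(h) = ∫ β(u)·conj ψ_S(u)·Σ'_{q ∈ REST} f(γ_q u h) dνN(u) = 0` for a non-degenerate `T_L`-skew index** (`det S ≠ 0`),
under the absolute-convergence binder (H) of ★ O41.4.  Fubini for series; REST = ⊔ right `N_Δ(L⁺)`-orbits (§1), regrouped by `tsum_sigma` along
`q ↦ O(q)`; each orbit is `O(w_χ p')` for a middle representative (★ B2c face (X) — its representative is off `P_Δ` and, by ★
`exists_rat_siegel_weylDelta_unip`, off the big cell) and dies by ★ Φ2 file 7 `tsum_middle_orbit_eq_zero`.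
[cite: KudlaRallis1994, §2] [cite: Tan1999, §3] [cite: Shimura1997, §18.3] [cite: MoeglinWaldspurger1995, II.1.7] -/
theorem integral_rest_eq_zero (hdV0 : ∀ i, dV i ≠ 0) (hdW0 : ∀ i, dW i ≠ 0) (νN : Measure (unipDelta L e dV hdV dW hdW)) [νN.IsMulLeftInvariant]
    {β : unipDelta L e dV hdV dW hdW → ℝ≥0∞} (hβ : IsCoveringWeight (unipDeltaRat L e dV hdV dW hdW) β)
    {χH : HeckeCharacter L} {s : ℂ} {f : HA L e dV hdV dW hdW → ℂ} (hf : IsSiegelDeltaSection L e dV hdV dW hdW χH s f) (hfc : Continuous f)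
    (h : HA L e dV hdV dW hdW)
    (hH : ∫⁻ u, (∑' q : SiegelDeltaQuot L e dV hdV dW hdW,
        ‖f ((((Quotient.out q : ratH L e dV hdV dW hdW) : HA L e dV hdV dW hdW)) * ((u : HA L e dV hdV dW hdW) * h))‖ₑ) * β u ∂νN ≠ ∞)
    {S : Matrix (Fin n) (Fin n) L}
    (hS : S ∈ skewMatrices ((IsCMField.complexConj L : L ≃ₐ[Fp L] L) : L →+* L) ((gramR L e dV hdV dW hdW).map (algebraMap (Fp L) L))) (hdet : S.det ≠ 0) :
    ∫ u, (β u).toReal • (conj (unipDeltaChar L e dV hdV dW hdW S (u : HA L e dV hdV dW hdW) : ℂ) *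
      (∑' q : ↥(({Quotient.mk (MulAction.orbitRel (siegelDeltaRat L e dV hdV dW hdW) (ratH L e dV hdV dW hdW)) 1} ∪
        Set.range (fun ν : unipDeltaRat L e dV hdV dW hdW =>
          (Quotient.mk (MulAction.orbitRel (siegelDeltaRat L e dV hdV dW hdW) (ratH L e dV hdV dW hdW)) (wq ν) :
            SiegelDeltaQuot L e dV hdV dW hdW)))ᶜ : Set (SiegelDeltaQuot L e dV hdV dW hdW)),
      f ((((Quotient.out (q : SiegelDeltaQuot L e dV hdV dW hdW) : ratH L e dV hdV dW hdW) : HA L e dV hdV dW hdW)) *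
        ((u : HA L e dV hdV dW hdW) * h)))) ∂νN = 0 := by
  classical
  haveI : Countable (unipDeltaRat L e dV hdV dW hdW) := countable_unipDeltaRat L e dV hdV dW hdW
  haveI : Countable (ratH L e dV hdV dW hdW) := countable_ratH L e dV hdV dW hdW
  haveI : Countable (SiegelDeltaQuot L e dV hdV dW hdW) := by unfold SiegelDeltaQuot; exact inferInstance
  -- notation
  set mk : ratH L e dV hdV dW hdW → SiegelDeltaQuot L e dV hdV dW hdW :=
    Quotient.mk (MulAction.orbitRel (siegelDeltaRat L e dV hdV dW hdW) (ratH L e dV hdV dW hdW)) with hmk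
  set R : Set (SiegelDeltaQuot L e dV hdV dW hdW) := ({mk 1} ∪ Set.range (fun ν : unipDeltaRat L e dV hdV dW hdW => mk (wq ν)))ᶜ with hR
  set orb : SiegelDeltaQuot L e dV hdV dW hdW → Set (SiegelDeltaQuot L e dV hdV dW hdW) := fun q =>
    Set.range (fun ν : unipDeltaRat L e dV hdV dW hdW =>
      mk ((Quotient.out q : ratH L e dV hdV dW hdW) * ⟨((ν : unipDelta L e dV hdV dW hdW) : HA L e dV hdV dW hdW), coe_mem_ratH ν⟩)) with horb
  set J : SiegelDeltaQuot L e dV hdV dW hdW → ℂ := fun q =>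
    ∫ u, (β u).toReal • (conj (unipDeltaChar L e dV hdV dW hdW S (u : HA L e dV hdV dW hdW) : ℂ) *
      f ((((Quotient.out q : ratH L e dV hdV dW hdW) : HA L e dV hdV dW hdW)) * ((u : HA L e dV hdV dW hdW) * h))) ∂νN with hJ
  -- Step 1: Fubini for series under (H)
  have hgm : ∀ q : SiegelDeltaQuot L e dV hdV dW hdW, AEStronglyMeasurable (fun u : unipDelta L e dV hdV dW hdW =>
      (β u).toReal • (conj (unipDeltaChar L e dV hdV dW hdW S (u : HA L e dV hdV dW hdW) : ℂ) *
        f ((((Quotient.out q : ratH L e dV hdV dW hdW) : HA L e dV hdV dW hdW)) * ((u : HA L e dV hdV dW hdW) * h)))) νN :=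
    fun q => aestronglyMeasurable_wt_smul_conj_mul_apply νN hβ.1 S hfc _ h
  have hsum : ∑' q : SiegelDeltaQuot L e dV hdV dW hdW, ∫⁻ u, ‖(β u).toReal • (conj (unipDeltaChar L e dV hdV dW hdW S (u : HA L e dV hdV dW hdW) : ℂ) *
      f ((((Quotient.out q : ratH L e dV hdV dW hdW) : HA L e dV hdV dW hdW)) * ((u : HA L e dV hdV dW hdW) * h)))‖ₑ ∂νN ≠ ∞ := by
    simp_rw [enorm_wt_smul_conj_mul hβ S]
    rw [← lintegral_tsum (f := fun (q : SiegelDeltaQuot L e dV hdV dW hdW) (u : unipDelta L e dV hdV dW hdW) =>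
        ‖f ((((Quotient.out q : ratH L e dV hdV dW hdW) : HA L e dV hdV dW hdW)) * ((u : HA L e dV hdV dW hdW) * h))‖ₑ * β u)
      fun q => ((measurable_enorm_apply_mul_coe_mul' hfc _ h).mul hβ.1).aemeasurable]
    simp_rw [ENNReal.tsum_mul_right]
    exact hH
  have hsumR : ∑' q : ↥R, ∫⁻ u, ‖(β u).toReal • (conj (unipDeltaChar L e dV hdV dW hdW S (u : HA L e dV hdV dW hdW) : ℂ) *
      f ((((Quotient.out (q : SiegelDeltaQuot L e dV hdV dW hdW) : ratH L e dV hdV dW hdW) : HA L e dV hdV dW hdW)) * ((u : HA L e dV hdV dW hdW) * h)))‖ₑ ∂νN ≠ ∞ :=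
    ne_top_of_le_ne_top hsum (ENNReal.tsum_comp_le_tsum_of_injective Subtype.val_injective _)
  have h1 : ∫ u, (β u).toReal • (conj (unipDeltaChar L e dV hdV dW hdW S (u : HA L e dV hdV dW hdW) : ℂ) *
      (∑' q : ↥R, f ((((Quotient.out (q : SiegelDeltaQuot L e dV hdV dW hdW) : ratH L e dV hdV dW hdW) : HA L e dV hdV dW hdW)) *
        ((u : HA L e dV hdV dW hdW) * h)))) ∂νN = ∑' q : ↥R, J q := by
    rw [hJ, ← integral_tsum (fun q : ↥R => hgm q) hsumR]
    refine integral_congr_ae (ae_of_all _ fun u => ?_)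
    show (β u).toReal • (conj (unipDeltaChar L e dV hdV dW hdW S (u : HA L e dV hdV dW hdW) : ℂ) *
      (∑' q : ↥R, f ((((Quotient.out (q : SiegelDeltaQuot L e dV hdV dW hdW) : ratH L e dV hdV dW hdW) : HA L e dV hdV dW hdW)) *
        ((u : HA L e dV hdV dW hdW) * h)))) =
      ∑' q : ↥R, (β u).toReal • (conj (unipDeltaChar L e dV hdV dW hdW S (u : HA L e dV hdV dW hdW) : ℂ) *
        f ((((Quotient.out (q : SiegelDeltaQuot L e dV hdV dW hdW) : ratH L e dV hdV dW hdW) : HA L e dV hdV dW hdW)) * ((u : HA L e dV hdV dW hdW) * h)))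
    rw [tsum_const_smul'' (β u).toReal, tsum_mul_left]
  change (∫ u, (β u).toReal • (conj (unipDeltaChar L e dV hdV dW hdW S (u : HA L e dV hdV dW hdW) : ℂ) *
      (∑' q : ↥R, f ((((Quotient.out (q : SiegelDeltaQuot L e dV hdV dW hdW) : ratH L e dV hdV dW hdW) : HA L e dV hdV dW hdW)) *
        ((u : HA L e dV hdV dW hdW) * h)))) ∂νN) = 0
  rw [h1]
  -- Step 2: `J` is absolutely summable
  have hJs : Summable J := by
    refine Summable.of_norm_bounded (ENNReal.summable_toReal hsum) fun q => ?_
    rw [← toReal_enorm (J q)]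
    exact ENNReal.toReal_mono (ENNReal.ne_top_of_tsum_ne_top hsum q) (enorm_integral_le_lintegral_enorm _)
  -- Step 3: regroup REST along the fibres of `q ↦ O(q)`
  have hRorb : ∀ q : ↥R, orb q ⊆ R := fun q => orbit_subset_rest wq hwq q.2
  set π : ↥R → ↥(Set.range (fun q : ↥R => orb q)) := fun q => ⟨orb q, q, rfl⟩ with hπ
  have hreg : ∑' q : ↥R, J q = ∑' ω : ↥(Set.range (fun q : ↥R => orb q)), ∑' c : {q : ↥R // π q = ω}, J c.1 := by
    rw [← (Equiv.sigmaFiberEquiv π).tsum_eq (fun q : ↥R => J q)]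
    have hS : Summable ((fun q : ↥R => J (q : SiegelDeltaQuot L e dV hdV dW hdW)) ∘ (Equiv.sigmaFiberEquiv π)) :=
      (Equiv.summable_iff _).2 (hJs.subtype R)
    exact hS.tsum_sigma' fun ω => ((hJs.subtype R).comp_injective (i := fun c : {q : ↥R // π q = ω} => c.1) fun a b hab => Subtype.ext hab)
  rw [hreg]
  -- Step 4: every fibre is the orbit of a middle representative, and dies
  refine (tsum_congr fun ω => ?_).trans tsum_zero
  obtain ⟨q₀, hq₀⟩ := ω.2
  have hq₀' : orb q₀ = ω.1 := hq₀
  -- the fibre over `ω` is the orbit `O(q₀)`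
  have hfib : ∀ x : SiegelDeltaQuot L e dV hdV dW hdW, x ∈ orb q₀ ↔ ∃ hx : x ∈ R, π ⟨x, hx⟩ = ω := by
    intro x
    constructor
    · intro hx
      exact ⟨hRorb q₀ hx, Subtype.ext ((orbit_eq_of_mem hx).trans hq₀')⟩
    · rintro ⟨hxR, hx⟩
      have h1 : orb x = orb q₀ := (congrArg Subtype.val hx).trans hq₀'.symm
      rw [← h1]
      exact orbit_mem x
  let eω : {q : ↥R // π q = ω} ≃ ↥(orb q₀) :=
    { toFun := fun c => ⟨c.1.1, (hfib c.1.1).2 ⟨c.1.2, c.2⟩⟩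
      invFun := fun x => ⟨⟨x.1, ((hfib x.1).1 x.2).choose⟩, ((hfib x.1).1 x.2).choose_spec⟩
      left_inv := fun c => Subtype.ext (Subtype.ext rfl)
      right_inv := fun x => Subtype.ext rfl }
  have hsumω : ∑' c : {q : ↥R // π q = ω}, J c.1 = ∑' x : ↥(orb q₀), J x.1 :=
    calc ∑' c : {q : ↥R // π q = ω}, J c.1 = ∑' c : {q : ↥R // π q = ω}, J (eω c).1 := rfl
      _ = ∑' x : ↥(orb q₀), J x.1 := eω.tsum_eq (fun x : ↥(orb (q₀ : SiegelDeltaQuot L e dV hdV dW hdW)) => J x.1)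
  rw [hsumω]
  -- the representative `γ_q₀` is off `P_Δ` and off the big cell
  have hq₀R : (q₀ : SiegelDeltaQuot L e dV hdV dW hdW) ∉ ({mk 1} ∪ Set.range (fun ν : unipDeltaRat L e dV hdV dW hdW => mk (wq ν))) := q₀.2
  simp only [Set.mem_union, Set.mem_singleton_iff, Set.mem_range, not_or, not_exists] at hq₀R
  have hnbig : ¬ IsUnit (Matrix.fromBlocks (1 : Matrix (Fin n) (Fin n) (AdeleRing (𝓞 L) L)) 0 (-1) 1 *
      blk L e dV hdV dW hdW ((Quotient.out (q₀ : SiegelDeltaQuot L e dV hdV dW hdW) : ratH L e dV hdV dW hdW) : HA L e dV hdV dW hdW) *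
        Matrix.fromBlocks 1 0 1 1).toBlocks₂₁.det := by
    intro hu
    obtain ⟨p, ν, hpr, hpP, hνN, hνr, hγe⟩ := exists_rat_siegel_weylDelta_unip L e dV hdV dW hdW hdV0 hdW0
      ((Quotient.out (q₀ : SiegelDeltaQuot L e dV hdV dW hdW) : ratH L e dV hdV dW hdW)).2 hu
    refine hq₀R.2 ⟨⟨ν, hνN⟩, (mem_unipDeltaRat_iff L e dV hdV dW hdW _).2 hνr⟩ ?_
    refine ((mk_eq_mk_iff_isSiegelDelta _ _).2 ?_).trans (Quotient.out_eq (q₀ : SiegelDeltaQuot L e dV hdV dW hdW))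
    rw [hγe, hwq]
    show IsSiegelDelta L e dV hdV dW hdW (p * weylDelta L e dV hdV dW hdW * ν * (weylDelta L e dV hdV dW hdW * ν)⁻¹)
    simp only [mul_inv_rev, mul_assoc, mul_inv_cancel_left, mul_inv_cancel, mul_one]
    exact hpP
  obtain ⟨g, χ, p, p', hχ, ⟨k₀, hk₀⟩, hg, hgg, hpr, hpP, hp'r, hp'P, hγeq⟩ :=
    exists_siegel_mul_refl_mul_siegel L e dV hdV dW hdW hdV0 hdW0 ((Quotient.out (q₀ : SiegelDeltaQuot L e dV hdV dW hdW) : ratH L e dV hdV dW hdW)).2 hnbig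
  have hγ₀ : iotaGG L e dV hdV dW hdW (1, UnitaryGroup.rationalPairToAdelic (Fp L) L (IsCMField.complexConj L) N M (Matrix.diagonal dV) (Matrix.diagonal dW) g) * p' ∈
      ratH L e dV hdV dW hdW := mul_mem (iotaGG_one_mem_ratH L e dV hdV dW hdW g) hp'r
  -- the orbit of `q₀` is `O(w_χ p')`
  have horb : orb q₀ = Set.range (fun ν : unipDeltaRat L e dV hdV dW hdW =>
      Quotient.mk (MulAction.orbitRel (siegelDeltaRat L e dV hdV dW hdW) (ratH L e dV hdV dW hdW)) ((⟨_, hγ₀⟩ : ratH L e dV hdV dW hdW) * (⟨(((ν) : unipDelta L e dV hdV dW hdW) : HA L e dV hdV dW hdW), coe_mem_ratH (ν)⟩ : ratH L e dV hdV dW hdW))) := by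
    refine Set.ext fun x => ⟨?_, ?_⟩
    · rintro ⟨ν, rfl⟩
      refine ⟨ν, (mk_mul_right_iff _ _ _).2 ((mk_eq_mk_iff_isSiegelDelta _ _).2 ?_)⟩
      show IsSiegelDelta L e dV hdV dW hdW ((((Quotient.out (q₀ : SiegelDeltaQuot L e dV hdV dW hdW) : ratH L e dV hdV dW hdW) : HA L e dV hdV dW hdW)) *
        (iotaGG L e dV hdV dW hdW (1, UnitaryGroup.rationalPairToAdelic (Fp L) L (IsCMField.complexConj L) N M (Matrix.diagonal dV) (Matrix.diagonal dW) g) * p')⁻¹)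
      rw [hγeq]
      simp only [mul_inv_rev, mul_assoc, mul_inv_cancel_left, mul_inv_cancel, mul_one]
      exact hpP
    · rintro ⟨ν, rfl⟩
      refine ⟨ν, (mk_mul_right_iff _ _ _).2 ((mk_eq_mk_iff_isSiegelDelta _ _).2 ?_)⟩
      show IsSiegelDelta L e dV hdV dW hdW
        (iotaGG L e dV hdV dW hdW (1, UnitaryGroup.rationalPairToAdelic (Fp L) L (IsCMField.complexConj L) N M (Matrix.diagonal dV) (Matrix.diagonal dW) g) * p' *
          ((((Quotient.out (q₀ : SiegelDeltaQuot L e dV hdV dW hdW) : ratH L e dV hdV dW hdW) : HA L e dV hdV dW hdW)))⁻¹)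
      rw [hγeq]
      simp only [mul_inv_rev, mul_assoc, mul_inv_cancel_left]
      exact isSiegelDelta_inv L e dV hdV dW hdW hpP
  rw [tsum_congr_set_coe (fun x => J x) horb]
  -- integrability of the orbit from (H), and ★ Φ2 file 7
  refine tsum_middle_orbit_eq_zero hdV0 hdW0 νN hβ hf hfc hχ hg hgg hk₀ hp'r hp'P hγ₀ h hS hdet ?_
  refine ne_top_of_le_ne_top hH (lintegral_mono fun u => mul_le_mul' ?_ le_rfl)
  exact ENNReal.tsum_comp_le_tsum_of_injective Subtype.val_injective
    (fun q : SiegelDeltaQuot L e dV hdV dW hdW => ‖f ((((Quotient.out q : ratH L e dV hdV dW hdW) : HA L e dV hdV dW hdW)) * ((u : HA L e dV hdV dW hdW) * h))‖ₑ)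

include hwq in
/-- **Φ2: `∫ β(u)·conj ψ_S(u)·E(u h; f) dνN(u) = W_S(f)(h)` for a NON-DEGENERATE `T_L`-skew index** (`det S ≠ 0`, `n > 0`), under (H): the identity cell dies
(`ψ_S` is non-trivial, ★ Φ2 file 1 `fourierCoeff_cells_of_ne_one` + ★ `exists_unipDeltaChar_ne_one_of_ne_zero`) and the middle term dies
(`integral_rest_eq_zero`) — «for det β ≠ 0 only the big cell survives». [cite: KudlaRallis1994, §2] [cite: Tan1999, §3] [cite: Shimura1997, §18.3]
[cite: MoeglinWaldspurger1995, II.1.7] -/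
theorem integral_wt_smul_conj_mul_eisenstein_eq_whittaker (hdV0 : ∀ i, dV i ≠ 0) (hdW0 : ∀ i, dW i ≠ 0) (hn : 0 < n)
    (νN : Measure (unipDelta L e dV hdV dW hdW)) [νN.IsMulLeftInvariant]
    {β : unipDelta L e dV hdV dW hdW → ℝ≥0∞} (hβ : IsCoveringWeight (unipDeltaRat L e dV hdV dW hdW) β)
    {χH : HeckeCharacter L} {s : ℂ} {f : HA L e dV hdV dW hdW → ℂ} (hf : IsSiegelDeltaSection L e dV hdV dW hdW χH s f) (hfc : Continuous f)
    (h : HA L e dV hdV dW hdW)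
    (hH : ∫⁻ u, (∑' q : SiegelDeltaQuot L e dV hdV dW hdW,
        ‖f ((((Quotient.out q : ratH L e dV hdV dW hdW) : HA L e dV hdV dW hdW)) * ((u : HA L e dV hdV dW hdW) * h))‖ₑ) * β u ∂νN ≠ ∞)
    {S : Matrix (Fin n) (Fin n) L}
    (hS : S ∈ skewMatrices ((IsCMField.complexConj L : L ≃ₐ[Fp L] L) : L →+* L) ((gramR L e dV hdV dW hdW).map (algebraMap (Fp L) L))) (hdet : S.det ≠ 0) :
    ∫ u, (β u).toReal • (conj (unipDeltaChar L e dV hdV dW hdW S (u : HA L e dV hdV dW hdW) : ℂ) *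
        eisensteinSeriesDelta L e dV hdV dW hdW f ((u : HA L e dV hdV dW hdW) * h)) ∂νN =
      whittakerDelta L e dV hdV dW hdW νN S f h := by
  have hS0 : S ≠ 0 := by
    rintro rfl
    haveI : Nonempty (Fin n) := ⟨⟨0, hn⟩⟩
    exact hdet Matrix.det_zero
  obtain ⟨u₀, hu₀⟩ := exists_unipDeltaChar_ne_one_of_ne_zero hdV0 hdW0 hS hS0
  rw [fourierCoeff_cells_of_ne_one wq hwq hn νN hβ hf hfc h hH S hu₀, integral_rest_eq_zero wq hwq hdV0 hdW0 νN hβ hf hfc h hH hS hdet, add_zero]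

include hwq in
/-- **Φ2 — THE NORMALISED `S`-th FOURIER COEFFICIENT OF THE SIEGEL EISENSTEIN SERIES FOR `det S ≠ 0` IS THE TWISTED BIG-CELL INTEGRAL:**
  `E_S(h; f) := fourierCoeffDelta νN β S (E f) h = (∫ β dνN)⁻¹ · whittakerDelta νN S f h`
(`S` a non-degenerate `T_L`-skew rational index, `n > 0`, setting and binder (H) of ★ O41.4 `constTerm_three_cells`).  With ★ Φ1 `eq_tsum_fourierCoeffDelta`
(the expansion `E(u h) = Σ_S E_S(h) ψ_S(u)`) this is the coefficient the Euler product (Φ3) and the continuation (Φ4) are about; the degenerate indices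
`det S = 0` keep their middle cells. [cite: KudlaRallis1994, §2] [cite: Tan1999, §3] [cite: Shimura1997, §18.3] [cite: MoeglinWaldspurger1995, II.1.7]
[cite: GelbartPiatetskishapiroRallis1987, Part A §§1–2] -/
theorem fourierCoeffDelta_eisensteinSeriesDelta_eq (hdV0 : ∀ i, dV i ≠ 0) (hdW0 : ∀ i, dW i ≠ 0) (hn : 0 < n)
    (νN : Measure (unipDelta L e dV hdV dW hdW)) [νN.IsMulLeftInvariant]
    {β : unipDelta L e dV hdV dW hdW → ℝ≥0∞} (hβ : IsCoveringWeight (unipDeltaRat L e dV hdV dW hdW) β)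
    {χH : HeckeCharacter L} {s : ℂ} {f : HA L e dV hdV dW hdW → ℂ} (hf : IsSiegelDeltaSection L e dV hdV dW hdW χH s f) (hfc : Continuous f)
    (h : HA L e dV hdV dW hdW)
    (hH : ∫⁻ u, (∑' q : SiegelDeltaQuot L e dV hdV dW hdW,
        ‖f ((((Quotient.out q : ratH L e dV hdV dW hdW) : HA L e dV hdV dW hdW)) * ((u : HA L e dV hdV dW hdW) * h))‖ₑ) * β u ∂νN ≠ ∞)
    {S : Matrix (Fin n) (Fin n) L}
    (hS : S ∈ skewMatrices ((IsCMField.complexConj L : L ≃ₐ[Fp L] L) : L →+* L) ((gramR L e dV hdV dW hdW).map (algebraMap (Fp L) L))) (hdet : S.det ≠ 0) :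
    fourierCoeffDelta L e dV hdV dW hdW νN β S (eisensteinSeriesDelta L e dV hdV dW hdW f) h =
      ((∫⁻ u, β u ∂νN).toReal⁻¹ : ℝ) • whittakerDelta L e dV hdV dW hdW νN S f h := by
  have hS0 : S ≠ 0 := by
    rintro rfl
    haveI : Nonempty (Fin n) := ⟨⟨0, hn⟩⟩
    exact hdet Matrix.det_zero
  obtain ⟨u₀, hu₀⟩ := exists_unipDeltaChar_ne_one_of_ne_zero hdV0 hdW0 hS hS0
  rw [fourierCoeffDelta_eisensteinSeriesDelta_of_ne_one wq hwq hn νN hβ hf hfc h hH S hu₀,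
    integral_rest_eq_zero wq hwq hdV0 hdW0 νN hβ hf hfc h hH hS hdet, add_zero]

end Main

end Summit.HodgeConjecture.HodgeConjecture.Cruxes.HLiu418.K2LiuSiegelEisensteinCoeffNondegenerate

end
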